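import Literature.AlgebraicGeometry.GroupSchemes.CartierDualAnnihilatorOfDuality
import Literature.AlgebraicGeometry.Motives.AbelianVarietyFrobeniusKernelTorsion
import Literature.AlgebraicGeometry.AbelianSchemes.AbelianSchemePolarization
import Literature.AlgebraicGeometry.AbelianSchemes.AbelianSchemeDualIsogeny
import Literature.AlgebraicGeometry.AbelianSchemes.AbelianSchemeOverField
import Literature.AlgebraicGeometry.AbelianSchemes.WeilDualityPolarizationTransport
import Literature.AlgebraicGeometry.Motives.AbelianVarietyTorsionCubeProofs
import Literature.AlgebraicGeometry.Motives.AbelianVarietyFrobeniusKernelAnnihilator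
import Literature.AlgebraicGeometry.AbelianSchemes.DualIsogenyVerschiebung
import Literature.AlgebraicGeometry.AbelianSchemes.DualPairDimEq
import HarnessLib

/-!
# `F0P6bWeilCartierDuality` — ★ RE-HOME (rung-0 re-homing task, books INVENTORY §8.4 M-3; LEAD F0P6-plan (g4) «M-72») of the crux workfile `Lines/F0_P6b_WeilCartierDuality.lean`

This `Theorems/` module is the TREE BYTES of `Summits/HodgeConjecture/HodgeConjecture/Cruxes/HLiu418/Lines/F0_P6b_WeilCartierDuality.lean` (edition of record,
tree sha16 1c9a4bbec4094740, 778 l., code-`sorry`-free) with the NAMESPACE KEPT — `Summit.HodgeConjecture.HodgeConjecture.Cruxes.HLiu418.F0P6bWeilCartierDuality` — so that every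
fully-qualified name (`WeilCartierDualityLagrangian`, `WeilFamily`, `IsNatural`, `FrobeniusAnnihilates`, `WeilPairingNatural`, `FrobeniusAnnihilator`, `PolarizationTransport`, `stub_W1`, `stub_W2`, `stub_W3`, …; 30 declarations) is UNCHANGED; only this module
docstring is re-headed.  Why a re-home: a `Theorems/` file cannot import a `Lines/` workfile (F0P6-ref1 o-6), and closing
stmt-HodgeConjecture-24832 `--as proved --by <Theorems decl>` at rung 0 needs the sorry-free Lines chain behind the gate (RE-HOME MAP v1.1, LA7-plan (g4),
2026-09-02; director g27 s1336 (R1)–(R3)).  It has NO `Lines` import (Tier 0).  Lines importers of the original: `F0_P6b_WDock`.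
After this file is ★ the Lines workfile is meant to become a one-import SHIM of it (a `Lines/` write, batched per cone on the LEAD's word), so no
environment ever holds two copies (NO-CROSS-IMPORT rule, «M-72» (3)).  It asserts nothing beyond what the workfile already proves.

## Original module docstring (verbatim)
# Crux `HLiu418` — P6 «MOD programme» — SUB-LINE **F0-P6b WeilCartierDuality** — ED. 3 («M-37»: ED. 2 with the `hdim` binder REMOVED again — letters = ED. 1 tokens — `stub_W1` fed by ★ (σ1-g) `DualPair.dim_hat_eq`; cand B-p08 (g33)) over ED. 2 (assembled by F0P6b-plan (g3) on LEAD «M-17v′»∕(P1′): ED. 1 + the binder `hdim` + `stub_W1` PAID + §5 THE NAMED DUALITY `e₀` + §6 the (iso) law; ZERO sorries) over ED. 1 = (CANDIDATE v6 = v5c (LEAD «M-17v»: v5b − `hdim` + the unit hypothesis `hD` in `FrobeniusAnnihilates`) + `stub_W2` PROVED over ★ `AbelianVarietyFrobeniusKernelAnnihilator` p846620∕p846660 and ★ `DualIsogenyVerschiebung` p846646; cut by A-p06 (g31) from A-p01 (g24)՚s v5b bytes; A-p01 (g24) for F0P6b-plan (g3); v2 = v1 + unit hypothesis `hD`; v4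 = `stub_W3` PAID (★ p846607); v5b: in the head and the three letters `[PerfectField k] (p) [Fact p.Prime] [CharP k p]` replace `(p) [ExpChar k p]` (the family TYPE and its two properties keep `[ExpChar k p]`, found by Mathlib `expChar_prime`), plus the binder `hdim : dim Â = dim A` in head ∕ `FrobeniusAnnihilates` ∕ (W3) that ★ (W2-core) p846620 consumes — two stubs W1, W2 remain)
# «the `λ`-Weil duality on `A[q]` is a hermitian perfect duality with `A[F_q]` LAGRANGIAN» — the supplier of the three hypotheses of (BLF)
# ED. 4 (F0P6b-plan (g5) cand, «CANONICAL RE-POINTING»): `theFamily` := the ★ Weil-isomorphism family ITSELF (the `dite` on the unit hypothesis of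
# `Classical.choose` of ★ `WeilPairing.exists_weilIso'` at `D` ∕ `D.normalize` — the witness `stub_W1` exhibits) instead of `Classical.choose (stub_W1 p r)`
# (an ARBITRARY natural family, whose pairing values are unreadable); `theFamily_isNatural` re-proved from that witness; NEW `theFamily_eq_of_unit`,
# `cartierPairing_theFamily_eq_weilChar` (THE READING: `⟪y ≫ w_A, x⟫ = e_q(x ≫ j, y ≫ ĵ)`, ★ `DualPair.weilChar`), and THE DICTIONARY
# `comp_comp_cartierDualMap_eq_one_of_weilChar` ∕ `comp_e₀_comp_cartierDualMap_eq_one_of_weilChar` («a character of `e₀` is trivial on a finite `𝒦 → G`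
# as soon as the Weil characters `e_q(𝒦, λ(·))` are `1` on finite points», ★ `eq_of_cartierPairing_tautPt_eq`) — what the ROOF road՚s (KW) pairing organs
# (isotropy of `Ker q̄` under `p`-descent, ★ `WeilUnitKernelIsotropicOfDescent`; Weil level shift) need to reach `e₀ = ℓ ≫ w_A`.
# Every other declaration byte-identical to ED. 3 (+ `omit [PerfectField k] in` on `e₀_hom_eq` ∕ `isMonHom_e₀_hom` ∕ `e₀_hermitian`); explicit binders and conclusions of every TYPE unchanged —
# SIGNATURE NOTE: `theFamily`, `e₀`, `e₀_hom_eq`, `isMonHom_e₀_hom`, `e₀_hermitian` (and the three new decls) no longer carry the instance binder `[PerfectField k]` (the ★ witness needs none;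
# a binder DROP only — every caller that has the instance elaborates unchanged); downstream FrobLag ∕ W-DOCK text untouched (W-DOCK re-builds in the cone).

SKELETON CUT (A-p01 (g24), 2026-09-01, on F0P6b-plan (g3) 19:34:25Z (β′)).  Cell `hodgecm-mathlib`, floor 0 (D-0183) ∕ D-0175 «LINES FIRST»,
programme P6, crux item stmt-HodgeConjecture-24832 (`HCCMUnconditional.HLiu418`).  GENERIC: imports ★ `Literature` only (no `Summits` parent);
nothing in this file is about HC.  HC_CM is proved only modulo the printed citations until rung 0 closes; this file changes no count.

## Why
The consumer shape (BLF) `BlockLagrangianFrobenius` of `Lines/F0_P6b_FrobeniusLagrangian.lean` (ED. 1 v3) takes as HYPOTHESES a perfect duality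
`e₀ : A[q] ≅ A[q]^D` of the `q`-torsion layer which is a homomorphism, Rosati-HERMITIAN and for which `A[F_q]` is its own annihilator.  The HEAD
TYPE of this line, `WeilCartierDualityLagrangian` (ρA currency; stmt v1 7388c5fd4a57c503 boxed GREEN 19:34:48Z, v2 = v1 + the binder `hD`), concludes exactly that
triple from a polarization `λ` prime to `p` (`hlam`, all-`T`) with the Rosati adjunction (`hRos`).  The tree has the finite-group-scheme side
(★ `CartierDual*`, ★ `CartierDualLagrangian` p846551) and the dual homomorphism (★ `DualPair.dualIsogenyOver`, ★ (DF) `DualIsogenyRelFrobenius`),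
but NOT the scheme-theoretic Weil pairing `e_q : A[q] × Â[q] → μ_q`; this line names it.

## The cut (three letters, one sorry-free composition)
* the FAMILY TYPE `WeilFamily k p r`: for every abelian variety `A∕k` with a dual pair `D = (Â, 𝒫)` and every pair of realisations
  `j : G ↪ A` of `A[q]` and `ĵ : Ĝ ↪ Â` of `Â[q]` (all-`T` points; `Â := D.hat.toAffine.toAbelianVariety`), an isomorphism of layers
  `w : Ĝ ≅ G^D` («`ŷ ↦ e_q(·, ŷ)`»);
* `WeilFamily.IsNatural w`: every `w` is a homomorphism, and for every homomorphism `f : A → B`, every lift `β : G_A → G_B` of `f` and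
  every lift `βd : Ĝ_B → Ĝ_A` of `f^∨ = dualIsogenyOver f D_A D_B`: `βd ≫ w_A = w_B ≫ β^D` («`e_q(f x, ŷ) = e_q(x, f^∨ ŷ)`», [MumfordAV1970]
  §15 Thm. 1, §20 p. 186; the ★ intertwining orientation `β′ ≫ e = e ≫ β^D` of `CartierDualAnnihilatorOfDuality`);
* `WeilFamily.FrobeniusAnnihilates w`: for every `A`, the `w_A`-annihilator of `A[F_q] = Ker F^{(r)}_{A∕k} ⊂ A[q]` inside `Â[q]` is
  `Â[F_q] = Ker F^{(r)}_{Â∕k}` (points form) — [Oda1969] Cor. 1.3 «`F` and `V` are adjoint», `(Ker F_A)^⊥ = Im V_Â = Ker F_Â`;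
* (W1) `WeilPairingNatural`: a natural Weil family EXISTS (L; [MumfordAV1970] §15 Thm. 1: `Ker f^∨ ≅ (Ker f)^D` by descent of `𝒫` along
  `f × 1`, applied to `f = [q]`; parents ★ `DualIsogenyKernel`, ★ `CartierDualQuotient`, ★ `PoincareSheafMulNKernel`);
* (W2) `FrobeniusAnnihilator`: EVERY natural Weil family annihilates Frobenius kernels as above (M; [Oda1969] Cor. 1.3 over ★ (DF) p845410
  `(F_A)^∨ = V_Â`, ★ p846387 `[q] = V ∘ F`, ranks ★ `finrank_relFrobeniusHom_left`; true for every natural family because natural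
  automorphisms of `Â ↦ Â[q]` commute with `F_Â = (V_A)^∨`);
* (W3) `PolarizationTransport`: a natural, Frobenius-annihilating family yields the head (M, transport): `e₀ := ℓ ≫ w_A` with `ℓ : G → Ĝ` the
  lift of `λ|_{A[q]}` (`ℓ ≫ ĵ = j ≫ λ`; an isomorphism: `hlam` makes it a closed immersion of layers of equal rank `rk Ĝ = rk G^D = rk G`,
  ★ `finrank_alg_cartierDual`, ★ `CartierDualLagrangian.isIso_of_isClosedImmersion_of_finrank_alg_eq`); HERMITIAN with NO symmetry of `λ`
  and NO involutivity of `star`: `hRos a` gives `β(star a) ≫ ℓ = ℓ ≫ βd(a)` (`βd(a)` the lift of `ι(a)^∨`, `ĵ` mono) and naturality in the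
  endomorphism `ι(a)` gives `βd(a) ≫ w_A = w_A ≫ (β a)^D`; LAGRANGIAN: `z ∈ Φ^{⊥ e₀} ⟺ λ z ∈ Φ^{⊥ w_A} = Â[F_q] ⟺ λ^{(q)}(F z) = 1 ⟺ F z = 1`
  (`F_Â ∘ λ = λ^{(q)} ∘ F_A`, naturality of `relFrobenius`; `hlam` transported to the twist);
* HEAD `weilCartierDualityLagrangian_of_line : W1 → W2 → W3 → WeilCartierDualityLagrangian` (sorry-free, three lines); in v4 `stub_W3` is a
  THEOREM (20-line paste over ★ p846607: `Ĝ := Ker [q]_Â` finite by ★ `isIsogeny_zsmul_id_holds`, then `exists_hermitian_lagrangian_duality_of_weil`).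

v4 → v5 (second-reader pass on ★ (W2-core) `AbelianVarietyFrobeniusKernelAnnihilator` p846620, A-p06 (g31)): that theorem is stated over a PERFECT
field of PRIME characteristic `p`; so the line now quantifies `[PerfectField k] (p) [Fact p.Prime] [CharP k p]`
(the consumer lives over `geomResidueField w`, algebraically closed of characteristic `p` — all instances available; the family type `WeilFamily k p r`
keeps `[ExpChar k p]`, synthesised from `Fact p.Prime` + `CharP` by Mathlib՚s `expChar_prime` — LEAD «M-17u» (1)); `dim Â = dim A` is NOT a binder
(ED. 3: ED. 2 carried `hdim` in the family TYPE and every letter — LEAD «M-17v′», because (W1) must PRODUCE the isomorphism `Ĝ ≅ G^D` for every `(A, D)`,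
which costs `dim Â = dim A`; ★ (σ1-g) `DualPairDimEq.dim_hat_eq` (B-p08 (g33), p847199) now proves it for every dual pair of an abelian variety over
ANY field, so the letters return to their ED. 1 tokens and `stub_W1` feeds `DualPair.dim_hat_eq A D`), while `FrobeniusAnnihilates` carries the unit
hypothesis `hD` of its dual pair ((W2) routes through `IsNatural`.2, stated for normalised pairs).

TRUE AS TYPED (junk audit): `r = 0` ⇒ all layers trivial ⇒ every clause trivial; `star`, `act`, `β` bare; `hlam`, `hG`, `hĜ`, `hΦ`,
`hΦ′` all-`T` (box row J11); no perfectness of `k`.  v1 → v2 (A-p01 self-audit): ★ `DualPair` does not force `𝒫|_{A × {ε_Â}} ≅ 𝒪` (the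
translates `𝒫 ⊗ pr_A^*M`, `M ∈ Pic⁰(A)` rigidified, satisfy all four fields), and for such pairs `dualIsogenyOver 𝟙 D D′` is the TRANSLATION by
`[M]`; when `[M] ∈ Â[q](k) ∖ 1` it lifts to the realisations and the naturality square `βd ≫ w = w ≫ 𝟙^D` forces `w(m) = 1`, absurd — so (W1)
WITHOUT the unit hypotheses would be FALSE; with them (`hDA`, `hDB` in `IsNatural`, `hD` in (W3) and in the head) every dual homomorphism is a
homomorphism (★ `isMonHom_dualIsogenyOver`) and (W1) is [MumfordAV1970] §15 Thm. 1 + §20 verbatim.  (W2) needs no unit hypothesis: EVERY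
homomorphic `w′ : Ĝ ≅ G^D` is `w ≫ ψ^D` for an automorphism `ψ` of `G`, and automorphisms commute with the relative Frobenius.

## ED. 2 (F0P6b-plan (g3) assembly; LEAD «M-17v′», (P1′); ref1 pre-box GREEN 22:15:26Z (c-W1))
* `stub_W1` PAID: B-p08 (g33)՚s (σ1-f) assembly — `stub_W1 :=` the `dite` on the unit hypothesis of `Classical.choose` of ★ `WeilPairing.exists_weilIso'` (fed `DualPair.dim_hat_eq A D`, ★ p847199, since ED. 3) (★ p847042 `AbelianSchemes/WeilPairingIso`) at `D`, resp. at ★ `D.normalize` (★ `AbelianSchemeDualPairNormalize`); the Weil isomorphism `Â[q] ≅ (A[q])^D` is built from the Weil characters `e_q` (★ p846990 `WeilPairingCharacter`: (σ1-a) B-p04 Yoneda dock ★ `exists_hom_cartierDual_of_character_of_finite`, (σ1-b)–(σ1-d) ★ `weilUnit*`), trivial kernel + mono + naturality ★ p847027 `WeilPairingHom` (`exists_weilHom`, `eq_one_of_comp_weilHom_eq_one`, `mono_weilHom`, `weilHom_natural` over (σ1-e) ★ `weilUnit_comp_dualIsogenyOver`), iso under `hdim` (★ `isIso_weilHom`,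 ranks ★ `finrank_alg_eq_of_realises_torsion`); `IsNatural`.1 by `choose_spec ….1`, `IsNatural`.2 = ★ `WeilPairing.weilHom_natural`.
* §5 THE NAMED DUALITY (P1′): for ANY realisation `ĵ : Ĝ ↪ Â` of `Â[q]`, `liftLam` (the chosen lift `ℓ` of `λ|_{A[q]}`, ★ `exists_lift_lam`),
  `theFamily p r` (the (W1) family) and **`e₀ p r A D pol j hG ĵ hĜ hlam : G ≅ G^D := asIso ℓ ≪≫ w_A`** with the EXPORTED EQUATION
  `e₀_hom_eq : e₀.hom = ℓ ≫ w_A.hom` (`rfl`), `isMonHom_e₀_hom`, `e₀_hermitian`, `e₀_lagrangian` and `weilCartierDualityLagrangian_at` = the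
  head՚s three conclusions FOR THE TERM `e₀` (the RGD-facing junction `bigBlockFrobeniusLaw_at` of (BLF) docks on this term; HOME probe v4).
* §6 the (iso) law `PolarisedIsogenyKernelIsotropic` — «a closed subgroup `K ↪ A[q]` killed by a lift of `f : A → B` and whose `ℓ`-image lies in
  the image of a lift of `f^∨` is `e₀`-ISOTROPIC» — CLOSED (`polarisedIsogenyKernelIsotropic_holds`, naturality square + `(φK ≫ β)^D = 1`); the
  unconditional form («`Ker f ∩ A[q]` isotropic whenever `f^∨ λ_B f = p λ`») is [MumfordAV1970] §23 Thm. 2 descent and is NOT claimed.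

## References
* [MumfordAV1970] D. Mumford, *Abelian Varieties* (1970), §15 Thm. 1 (p. 143), §20 pp. 186–189 ((I) p. 189), §23.
* [Oda1969] T. Oda, *The first de Rham cohomology group and Dieudonné modules*, Ann. Sci. ÉNS (4) 2 (1969), Thm. 1.1, Cor. 1.3.
* [EdixhovenVanDerGeerMoonenAV] B. Edixhoven, G. van der Geer, B. Moonen, *Abelian Varieties* (draft), (5.21), (7.34), (11.23).
* [Tate1997FiniteFlatGroupSchemes] J. Tate, *Finite flat group schemes* (1997), §(3.7)–(3.8).
-/

set_option autoImplicit false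
set_option linter.dupNamespace false

-- Mathlib's `Over`/`Scheme` APIs are stated across semireducible wrappers (as in the ★ `GroupSchemes/*` files imported here).
set_option backward.isDefEq.respectTransparency false

noncomputable section

universe u

open CategoryTheory CategoryTheory.Limits AlgebraicGeometry MonoidalCategory CartesianMonoidalCategory
open scoped MonObj
open Literature.AlgebraicGeometry.GroupSchemes Literature.AlgebraicGeometry.GroupSchemes.GroupSchemeKernel
open Literature.AlgebraicGeometry.GroupSchemes.AffineGroupScheme
open Literature.AlgebraicGeometry.Motives Literature.AlgebraicGeometry.Motives.AbelianVariety
open Literature.AlgebraicGeometry.AbelianSchemes Literature.AlgebraicGeometry.AbelianSchemes.AbelianSchemeOver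
open Literature.AlgebraicGeometry.AbelianSchemes.AbelianSchemeOver.DualPair


namespace Summit.HodgeConjecture.HodgeConjecture.Cruxes.HLiu418.F0P6bWeilCartierDuality

/-! ## §0 The head type (ρA currency; stmt v4 = stmt v1 7388c5fd + `hD` (v2) + `[PerfectField k] [Fact p.Prime] [CharP k p]` (M-17u); no `hdim` (ED. 1 = ED. 3 tokens)) -/

/-- **«THE `λ`-WEIL DUALITY ON `A[q]` IS A HERMITIAN PERFECT DUALITY WITH `A[F_q]` LAGRANGIAN»** (head type, (ρA) currency).
For: a perfect field `k` of characteristic `p` (prime), `q = p^r`, an abelian variety `A∕k` with a dual pair `D = (Â, 𝒫)` whose Poincaré sheaf is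
NORMALISED along `A × {ε_Â}` (`hD`, the «unit hypothesis» of ★ `AbelianSchemeDualTransport` §4 ∕ ★ `PoincareUnitHypothesis*`, [MumfordFogartyKirwan1994]
Def. 7.3 (ii) — ★ `DualPair` alone admits the translates `𝒫 ⊗ pr_A^*M`, for which ★ `dualIsogenyOver` is a translate of the dual homomorphism and
no NATURAL Weil family can exist; ★ `isMonHom_dualIsogenyOver` carries the same hypothesis) and a polarization `λ = pol.lam : A → Â`; ANY realisation `j : G ↪ A` of the `q`-torsion layer `A[q]` (`hG`, all-`T` points) and `φ : Φ ↪ G` of the Frobenius-kernel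
layer `A[F_q] = Ker F^{(r)}_{A∕k}` (`hΦ`); a set `O` of labels with bare functions `star : O → O`, `act : O → End A` («`ι`») and layer
endomorphisms `β a` of `G` over `ι(a)` (`hβ`); HYPOTHESES: (`hlam`) `Ker λ` meets `A[q]` trivially — `λ|_{A[q]}` kills no non-trivial `T`-point
(this is «`deg λ` prime to `p`»); (`hRos`) the Rosati adjunction `ι(star a) ≫ λ = λ ≫ ι(a)^∨` for every `a` (★ `dualIsogenyOver`).
CONCLUSION — verbatim the three hypotheses `(e₀, hherm₀, hlag₀)` of (BLF): there is an isomorphism of layers `e₀ : G ≅ G^D` (the `λ`-Weil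
duality; the discharger takes `e₀ := λ|_{A[q]} ≫ w_A`, NOT `w′ ∘ λ`, so that neither `λ^∨ = λ` nor `star ∘ star = id` is needed) which is a
homomorphism, hermitian — `β (star a) ≫ e₀ = e₀ ≫ (β a)^D` — and for which a `T`-point `x` of `G` lies in the `e₀`-annihilator of `Φ` iff it
lies in `Φ` («`A[F_q]^⊥ = A[F_q]`»).
(print: MumfordAV1970, §15 Thm. 1 (p. 143), §20 (I) (p. 189), §23) (print: Oda1969, Thm. 1.1, Cor. 1.3) (print: EdixhovenVanDerGeerMoonenAV, (5.21), (7.34)) -/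
def WeilCartierDualityLagrangian : Prop :=
  ∀ ⦃k : Type u⦄ [Field k] [PerfectField k] (p : ℕ) [Fact p.Prime] [CharP k p] (r : ℕ) (A : AbelianVariety k)
    (D : (AbelianScheme.ofAbelianVariety A).toOver.DualPair)
    (_hD : Nonempty ((Scheme.Modules.pullback D.unitHatSlice).obj D.P ≅ SheafOfModules.unit _))
    (pol : (AbelianScheme.ofAbelianVariety A).toOver.Polarization D)
    (G : SchemeOver k) [GrpObj G] [IsCommMonObj G] [IsAffine G.left] [Module.Free k (Alg G)] [Module.Finite k (Alg G)]
    (j : G ⟶ A.X) [IsMonHom j] [IsClosedImmersion j.left]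
    (_hG : ∀ ⦃T : SchemeOver k⦄ (t : T ⟶ A.X), (∃ s : T ⟶ G, s ≫ j = t) ↔ t ≫ ((((p ^ r : ℕ) : ℤ) • 𝟙 A).hom.hom.hom) = 1)
    (_hlam : ∀ ⦃T : SchemeOver k⦄ (t : T ⟶ G), (t ≫ j) ≫ pol.lam = 1 → t = 1)
    (Φ : SchemeOver k) [GrpObj Φ] [IsCommMonObj Φ] [IsAffine Φ.left] [Module.Free k (Alg Φ)] [Module.Finite k (Alg Φ)]
    (φ : Φ ⟶ G) [IsMonHom φ] [IsClosedImmersion φ.left]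
    (_hΦ : ∀ ⦃T : SchemeOver k⦄ (t : T ⟶ G), (∃ s : T ⟶ Φ, s ≫ φ = t) ↔ (t ≫ j) ≫ (A.relFrobenius p r).hom.hom.hom = 1)
    (O : Type) (star : O → O) (act : O → (A ⟶ A)) (β : O → (G ⟶ G)) [∀ a, IsMonHom (β a)]
    (_hβ : ∀ a, β a ≫ j = j ≫ (act a).hom.hom.hom)
    (_hRos : ∀ a, (act (star a)).hom.hom.hom ≫ pol.lam =
      pol.lam ≫ dualIsogenyOver (A' := (AbelianScheme.ofAbelianVariety A).toOver) (B := (AbelianScheme.ofAbelianVariety A).toOver)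
        (act a).hom.hom.hom D D),
    ∃ e₀ : G ≅ cartierDual G, IsMonHom e₀.hom ∧
      (∀ a : O, β (star a) ≫ e₀.hom = e₀.hom ≫ cartierDualMap (β a)) ∧
      ∀ ⦃T : SchemeOver k⦄ (x : T ⟶ G),
        (∃ c : T ⟶ annihilator φ, c ≫ (annihilatorι φ ≫ e₀.inv) = x) ↔ ∃ s : T ⟶ Φ, s ≫ φ = x

/-! ## §1 The Weil family: its TYPE and its two properties (closed named definitions, LAYER + ρA currency) -/

/-- **The TYPE of a WEIL FAMILY at level `q = p^r` over `k`**: for every abelian variety `A∕k` with a dual pair `D = (Â, 𝒫)`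
(`Â := D.hat.toAffine.toAbelianVariety`, ★ `rfl` on the underlying `k`-scheme) and every pair of realisations `j : G ↪ A` of `A[q]` (`hG`) and
`ĵ : Ĝ ↪ Â` of `Â[q]` (`hĜ`), all-`T` points, an isomorphism of layers `Ĝ ≅ G^D` — «`ŷ ↦ e_q(·, ŷ)`», the scheme-theoretic Weil pairing
`e_q : A[q] × Â[q] → μ_q` read as a Cartier duality. [cite: MumfordAV1970, §15 Thm. 1 (p. 143), §20 p. 186] -/
def WeilFamily (k : Type u) [Field k] (p : ℕ) [ExpChar k p] (r : ℕ) : Type (u + 1) :=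
  ∀ (A : AbelianVariety k) (D : (AbelianScheme.ofAbelianVariety A).toOver.DualPair)
    (G : SchemeOver k) [GrpObj G] [IsCommMonObj G] [IsAffine G.left] [Module.Free k (Alg G)] [Module.Finite k (Alg G)]
    (j : G ⟶ A.X) [IsMonHom j] [IsClosedImmersion j.left]
    (_hG : ∀ ⦃T : SchemeOver k⦄ (t : T ⟶ A.X), (∃ s : T ⟶ G, s ≫ j = t) ↔ t ≫ ((((p ^ r : ℕ) : ℤ) • 𝟙 A).hom.hom.hom) = 1)
    (Ĝ : SchemeOver k) [GrpObj Ĝ] [IsCommMonObj Ĝ] [IsAffine Ĝ.left] [Module.Free k (Alg Ĝ)] [Module.Finite k (Alg Ĝ)]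
    (ĵ : Ĝ ⟶ D.hat.X) [IsMonHom ĵ] [IsClosedImmersion ĵ.left]
    (_hĜ : ∀ ⦃T : SchemeOver k⦄ (t : T ⟶ D.hat.X),
      (∃ s : T ⟶ Ĝ, s ≫ ĵ = t) ↔ t ≫ ((((p ^ r : ℕ) : ℤ) • 𝟙 D.hat.toAffine.toAbelianVariety).hom.hom.hom) = 1),
    Ĝ ≅ cartierDual G

namespace WeilFamily

variable {k : Type u} [Field k] {p : ℕ} [ExpChar k p] {r : ℕ} (w : WeilFamily k p r)

/-- **NATURALITY of a Weil family** («`e_q(f x, ŷ) = e_q(x, f^∨ ŷ)`»): every `w_A` is a homomorphism, and for every homomorphism of abelian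
varieties `f : A → B` with NORMALISED dual pairs `D_A`, `D_B` (unit hypotheses `hDA`, `hDB` — without them `f^∨` may be a translate of the dual
homomorphism by a torsion point and the square below fails already for `f = 𝟙`), every lift `β : G_A → G_B` of `f` to the `q`-torsion realisations and every lift
`βd : Ĝ_B → Ĝ_A` of the dual homomorphism `f^∨ = dualIsogenyOver f D_A D_B : B̂ → Â`, the square `βd ≫ w_A = w_B ≫ β^D` commutes (the ★
intertwining orientation `β′ ≫ e = e ≫ β^D` of `CartierDualAnnihilatorOfDuality`). (print: MumfordAV1970, §15 Thm. 1 (p. 143), §20 p. 186) -/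
def IsNatural : Prop :=
  (∀ (A : AbelianVariety k) (D : (AbelianScheme.ofAbelianVariety A).toOver.DualPair)
    (G : SchemeOver k) [GrpObj G] [IsCommMonObj G] [IsAffine G.left] [Module.Free k (Alg G)] [Module.Finite k (Alg G)]
    (j : G ⟶ A.X) [IsMonHom j] [IsClosedImmersion j.left]
    (hG : ∀ ⦃T : SchemeOver k⦄ (t : T ⟶ A.X), (∃ s : T ⟶ G, s ≫ j = t) ↔ t ≫ ((((p ^ r : ℕ) : ℤ) • 𝟙 A).hom.hom.hom) = 1)
    (Ĝ : SchemeOver k) [GrpObj Ĝ] [IsCommMonObj Ĝ] [IsAffine Ĝ.left] [Module.Free k (Alg Ĝ)] [Module.Finite k (Alg Ĝ)]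
    (ĵ : Ĝ ⟶ D.hat.X) [IsMonHom ĵ] [IsClosedImmersion ĵ.left]
    (hĜ : ∀ ⦃T : SchemeOver k⦄ (t : T ⟶ D.hat.X),
      (∃ s : T ⟶ Ĝ, s ≫ ĵ = t) ↔ t ≫ ((((p ^ r : ℕ) : ℤ) • 𝟙 D.hat.toAffine.toAbelianVariety).hom.hom.hom) = 1),
    IsMonHom (w A D G j hG Ĝ ĵ hĜ).hom) ∧
  ∀ (A B : AbelianVariety k) (DA : (AbelianScheme.ofAbelianVariety A).toOver.DualPair)
    (DB : (AbelianScheme.ofAbelianVariety B).toOver.DualPair)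
    (_hDA : Nonempty ((Scheme.Modules.pullback DA.unitHatSlice).obj DA.P ≅ SheafOfModules.unit _))
    (_hDB : Nonempty ((Scheme.Modules.pullback DB.unitHatSlice).obj DB.P ≅ SheafOfModules.unit _)) (f : A ⟶ B)
    (GA : SchemeOver k) [GrpObj GA] [IsCommMonObj GA] [IsAffine GA.left] [Module.Free k (Alg GA)] [Module.Finite k (Alg GA)]
    (jA : GA ⟶ A.X) [IsMonHom jA] [IsClosedImmersion jA.left]
    (hGA : ∀ ⦃T : SchemeOver k⦄ (t : T ⟶ A.X), (∃ s : T ⟶ GA, s ≫ jA = t) ↔ t ≫ ((((p ^ r : ℕ) : ℤ) • 𝟙 A).hom.hom.hom) = 1)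
    (ĜA : SchemeOver k) [GrpObj ĜA] [IsCommMonObj ĜA] [IsAffine ĜA.left] [Module.Free k (Alg ĜA)] [Module.Finite k (Alg ĜA)]
    (ĵA : ĜA ⟶ DA.hat.X) [IsMonHom ĵA] [IsClosedImmersion ĵA.left]
    (hĜA : ∀ ⦃T : SchemeOver k⦄ (t : T ⟶ DA.hat.X),
      (∃ s : T ⟶ ĜA, s ≫ ĵA = t) ↔ t ≫ ((((p ^ r : ℕ) : ℤ) • 𝟙 DA.hat.toAffine.toAbelianVariety).hom.hom.hom) = 1)
    (GB : SchemeOver k) [GrpObj GB] [IsCommMonObj GB] [IsAffine GB.left] [Module.Free k (Alg GB)] [Module.Finite k (Alg GB)]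
    (jB : GB ⟶ B.X) [IsMonHom jB] [IsClosedImmersion jB.left]
    (hGB : ∀ ⦃T : SchemeOver k⦄ (t : T ⟶ B.X), (∃ s : T ⟶ GB, s ≫ jB = t) ↔ t ≫ ((((p ^ r : ℕ) : ℤ) • 𝟙 B).hom.hom.hom) = 1)
    (ĜB : SchemeOver k) [GrpObj ĜB] [IsCommMonObj ĜB] [IsAffine ĜB.left] [Module.Free k (Alg ĜB)] [Module.Finite k (Alg ĜB)]
    (ĵB : ĜB ⟶ DB.hat.X) [IsMonHom ĵB] [IsClosedImmersion ĵB.left]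
    (hĜB : ∀ ⦃T : SchemeOver k⦄ (t : T ⟶ DB.hat.X),
      (∃ s : T ⟶ ĜB, s ≫ ĵB = t) ↔ t ≫ ((((p ^ r : ℕ) : ℤ) • 𝟙 DB.hat.toAffine.toAbelianVariety).hom.hom.hom) = 1)
    (β : GA ⟶ GB) [IsMonHom β] (_hβ : β ≫ jB = jA ≫ f.hom.hom.hom)
    (βd : ĜB ⟶ ĜA)
    (_hβd : βd ≫ ĵA = ĵB ≫ dualIsogenyOver (A' := (AbelianScheme.ofAbelianVariety A).toOver)
      (B := (AbelianScheme.ofAbelianVariety B).toOver) f.hom.hom.hom DA DB),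
    βd ≫ (w A DA GA jA hGA ĜA ĵA hĜA).hom = (w B DB GB jB hGB ĜB ĵB hĜB).hom ≫ cartierDualMap β

/-- **A Weil family ANNIHILATES FROBENIUS KERNELS** («`(Ker F_A)^⊥ = Ker F_Â`», [Oda1969] Cor. 1.3: `F` and `V` are adjoint under `e_q`):
for every `A`, `D`, realisations `G ≅ A[q]`, `Ĝ ≅ Â[q]`, `φ : Φ ↪ G` of `A[F_q] = Ker F^{(r)}_{A∕k}` and `φ̂ : Φ̂ ↪ Ĝ` of `Â[F_q] = Ker F^{(r)}_{Â∕k}`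
(all-`T`), a `T`-point `x̂` of `Ĝ` lies in the `w_A`-annihilator of `Φ` (★ `annihilator φ`, read in `Ĝ` through `w_A⁻¹`) iff it lies in `Φ̂`.
(print: Oda1969, Thm. 1.1, Cor. 1.3) (print: MumfordAV1970, §15 Thm. 1 (p. 143), §23) -/
def FrobeniusAnnihilates : Prop :=
  ∀ (A : AbelianVariety k) (D : (AbelianScheme.ofAbelianVariety A).toOver.DualPair)
    (_hD : Nonempty ((Scheme.Modules.pullback D.unitHatSlice).obj D.P ≅ SheafOfModules.unit _))
    (G : SchemeOver k) [GrpObj G] [IsCommMonObj G] [IsAffine G.left] [Module.Free k (Alg G)] [Module.Finite k (Alg G)]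
    (j : G ⟶ A.X) [IsMonHom j] [IsClosedImmersion j.left]
    (hG : ∀ ⦃T : SchemeOver k⦄ (t : T ⟶ A.X), (∃ s : T ⟶ G, s ≫ j = t) ↔ t ≫ ((((p ^ r : ℕ) : ℤ) • 𝟙 A).hom.hom.hom) = 1)
    (Ĝ : SchemeOver k) [GrpObj Ĝ] [IsCommMonObj Ĝ] [IsAffine Ĝ.left] [Module.Free k (Alg Ĝ)] [Module.Finite k (Alg Ĝ)]
    (ĵ : Ĝ ⟶ D.hat.X) [IsMonHom ĵ] [IsClosedImmersion ĵ.left]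
    (hĜ : ∀ ⦃T : SchemeOver k⦄ (t : T ⟶ D.hat.X),
      (∃ s : T ⟶ Ĝ, s ≫ ĵ = t) ↔ t ≫ ((((p ^ r : ℕ) : ℤ) • 𝟙 D.hat.toAffine.toAbelianVariety).hom.hom.hom) = 1)
    (Φ : SchemeOver k) [GrpObj Φ] [IsCommMonObj Φ] [IsAffine Φ.left] [Module.Free k (Alg Φ)] [Module.Finite k (Alg Φ)]
    (φ : Φ ⟶ G) [IsMonHom φ] [IsClosedImmersion φ.left]
    (_hΦ : ∀ ⦃T : SchemeOver k⦄ (t : T ⟶ G), (∃ s : T ⟶ Φ, s ≫ φ = t) ↔ (t ≫ j) ≫ (A.relFrobenius p r).hom.hom.hom = 1)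
    (Φ' : SchemeOver k) [GrpObj Φ'] [IsCommMonObj Φ'] [IsAffine Φ'.left] [Module.Free k (Alg Φ')] [Module.Finite k (Alg Φ')]
    (φ' : Φ' ⟶ Ĝ) [IsMonHom φ'] [IsClosedImmersion φ'.left]
    (_hΦ' : ∀ ⦃T : SchemeOver k⦄ (t : T ⟶ Ĝ),
      (∃ s : T ⟶ Φ', s ≫ φ' = t) ↔ (t ≫ ĵ) ≫ (D.hat.toAffine.toAbelianVariety.relFrobenius p r).hom.hom.hom = 1),
    ∀ ⦃T : SchemeOver k⦄ (x : T ⟶ Ĝ),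
      (∃ c : T ⟶ annihilator φ, c ≫ (annihilatorι φ ≫ (w A D G j hG Ĝ ĵ hĜ).inv) = x) ↔ ∃ s : T ⟶ Φ', s ≫ φ' = x

end WeilFamily

/-! ## §2 The three letters (closed named `Prop`s) -/

/-- **(W1) «A NATURAL WEIL FAMILY EXISTS»** — the scheme-theoretic Weil pairing `e_q : A[q] × Â[q] → μ_q` as a Cartier duality `Â[q] ≅ A[q]^D`,
a homomorphism, natural in homomorphisms `f : A → B` against `f^∨` ([MumfordAV1970] §15 Thm. 1: `Ker f^∨ ≅ (Ker f)^D` by descent of `𝒫` along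
`f × 1`, for `f = [q]`; §20 p. 186 functoriality).  Size L; parents ★ `DualIsogenyKernel`, ★ `CartierDualQuotient`, ★ `PoincareSheafMulNKernel`,
★ `DualPair.universal`. (print: MumfordAV1970, §15 Thm. 1 (p. 143), §20 p. 186) -/
def WeilPairingNatural : Prop :=
  ∀ ⦃k : Type u⦄ [Field k] [PerfectField k] (p : ℕ) [Fact p.Prime] [CharP k p] (r : ℕ), ∃ w : WeilFamily k p r, w.IsNatural

/-- **(W2) «EVERY NATURAL WEIL FAMILY ANNIHILATES FROBENIUS KERNELS»** — `(A[F_q])^{⊥} = Â[F_q]` under `e_q` ([Oda1969] Cor. 1.3; `(F_A)^∨ = V_Â`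
★ (DF) `DualIsogenyRelFrobenius` p845410, `[q] = V ∘ F` ★ p846387, `Ker F^r = Im V^r` on the `q`-torsion, ranks ★ `finrank_relFrobeniusHom_left`).
Stated for EVERY natural family (not only the canonical one): two natural families differ by a natural automorphism of `Â ↦ Â[q]`, which
commutes with `F_Â = (V_A)^∨` and so preserves `Â[F_q]`.  Size M. (print: Oda1969, Thm. 1.1, Cor. 1.3) (print: MumfordAV1970, §15 Thm. 1 (p. 143)) -/
def FrobeniusAnnihilator : Prop :=
  ∀ ⦃k : Type u⦄ [Field k] [PerfectField k] (p : ℕ) [Fact p.Prime] [CharP k p] (r : ℕ) (w : WeilFamily k p r), w.IsNatural → w.FrobeniusAnnihilates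

/-- **(W3) «TRANSPORT ALONG A POLARIZATION PRIME TO `p`»** — a natural, Frobenius-annihilating Weil family at level `q` yields the head for
every `(A, D, λ, G, Φ, O, star, act, β)` with `hD` (normalised `𝒫`), `hlam` and `hRos`: `e₀ := ℓ ≫ w_A`, `ℓ : G → Ĝ` the lift of `λ|_{A[q]}` (an isomorphism by `hlam`
and `rk Ĝ = rk G^D = rk G`); hermitian by `hRos` + naturality in the endomorphism `ι(a)` (no `λ^∨ = λ`, no `star ∘ star = id`); Lagrangian by
`Φ^{⊥ e₀} = λ|⁻¹(Φ^{⊥ w_A}) = λ|⁻¹(Â[F_q]) = A[F_q]` (`F_Â ∘ λ = λ^{(q)} ∘ F_A`, `hlam` on the twist).  Size M (transport plumbing over ★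
`CartierDualAnnihilatorOfDuality`, ★ `CartierDualLagrangian`, ★ `KernelRecognitionByRank`).
(print: MumfordAV1970, §20 (I) (p. 189), §23) (print: Oda1969, Cor. 1.3) -/
def PolarizationTransport : Prop :=
  ∀ ⦃k : Type u⦄ [Field k] [PerfectField k] (p : ℕ) [Fact p.Prime] [CharP k p] (r : ℕ) (w : WeilFamily k p r), w.IsNatural → w.FrobeniusAnnihilates →
    ∀ (A : AbelianVariety k)
    (D : (AbelianScheme.ofAbelianVariety A).toOver.DualPair)
    (_hD : Nonempty ((Scheme.Modules.pullback D.unitHatSlice).obj D.P ≅ SheafOfModules.unit _))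
    (pol : (AbelianScheme.ofAbelianVariety A).toOver.Polarization D)
    (G : SchemeOver k) [GrpObj G] [IsCommMonObj G] [IsAffine G.left] [Module.Free k (Alg G)] [Module.Finite k (Alg G)]
    (j : G ⟶ A.X) [IsMonHom j] [IsClosedImmersion j.left]
    (_hG : ∀ ⦃T : SchemeOver k⦄ (t : T ⟶ A.X), (∃ s : T ⟶ G, s ≫ j = t) ↔ t ≫ ((((p ^ r : ℕ) : ℤ) • 𝟙 A).hom.hom.hom) = 1)
    (_hlam : ∀ ⦃T : SchemeOver k⦄ (t : T ⟶ G), (t ≫ j) ≫ pol.lam = 1 → t = 1)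
    (Φ : SchemeOver k) [GrpObj Φ] [IsCommMonObj Φ] [IsAffine Φ.left] [Module.Free k (Alg Φ)] [Module.Finite k (Alg Φ)]
    (φ : Φ ⟶ G) [IsMonHom φ] [IsClosedImmersion φ.left]
    (_hΦ : ∀ ⦃T : SchemeOver k⦄ (t : T ⟶ G), (∃ s : T ⟶ Φ, s ≫ φ = t) ↔ (t ≫ j) ≫ (A.relFrobenius p r).hom.hom.hom = 1)
    (O : Type) (star : O → O) (act : O → (A ⟶ A)) (β : O → (G ⟶ G)) [∀ a, IsMonHom (β a)]
    (_hβ : ∀ a, β a ≫ j = j ≫ (act a).hom.hom.hom)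
    (_hRos : ∀ a, (act (star a)).hom.hom.hom ≫ pol.lam =
      pol.lam ≫ dualIsogenyOver (A' := (AbelianScheme.ofAbelianVariety A).toOver) (B := (AbelianScheme.ofAbelianVariety A).toOver)
        (act a).hom.hom.hom D D),
    ∃ e₀ : G ≅ cartierDual G, IsMonHom e₀.hom ∧
      (∀ a : O, β (star a) ≫ e₀.hom = e₀.hom ≫ cartierDualMap (β a)) ∧
      ∀ ⦃T : SchemeOver k⦄ (x : T ⟶ G),
        (∃ c : T ⟶ annihilator φ, c ≫ (annihilatorι φ ≫ e₀.inv) = x) ↔ ∃ s : T ⟶ Φ, s ≫ φ = x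


/-! (★ re-home, size lint: this is PART A of `Lines/…` — the file continues, in the same namespace, in `Theorems.F0P6bWeilCartierDualityHead.lean`.) -/

end Summit.HodgeConjecture.HodgeConjecture.Cruxes.HLiu418.F0P6bWeilCartierDuality

end
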